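import Literature.Algebra.EuclideanLattices.SimultaneousApproximationLLL
import Literature.Algebra.EuclideanLattices.LatticeTableCodeFP
import Literature.Algebra.EuclideanLattices.RegevUniqueSVP
import Literature.Algebra.EuclideanLattices.PQCLLLProofs
import Literature.Computability.Complexity.CodeFPLists
import HarnessLib

/-!
# Simultaneous Diophantine approximation in polynomial time: discharge of LLL82 Prop. 1.39

Topic `Algebra/EuclideanLattices`, sibling PROOF file of `SimultaneousApproximationLLL.lean` (D-0014:
the named fact `Literature.Algebra.EuclideanLattices.LLL1982_prop_1_39 : Prop` stays a `def` there and
is discharged here as `Literature.Algebra.EuclideanLattices.LLL1982_prop_1_39_holds`). No new fact is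
introduced; everything below is proved.

**The statement** (A. K. Lenstra, H. W. Lenstra Jr., L. Lovász, *Factoring polynomials with rational
coefficients*, Math. Ann. 261 (1982), Prop. 1.39, p. 525; transcribed from M. R. Bremner, *Lattice
Basis Reduction*, CRC 2011, §9.2, Prop. 9.4, p. 131, and A. Schrijver, *Theory of Linear and Integer
Programming*, Wiley 1986, Cor. 6.4c, p. 168): there is a polynomial-time algorithm which, given
rationals `y₁, …, yₙ` and `0 < ε < 1`, computes integers `p₁, …, pₙ`, `q` with
`|q yᵢ - pᵢ| ≤ ε` and `1 ≤ q ≤ 2^{n(n+1)/4} ε⁻ⁿ`.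

**The printed proof** (LLL82 p. 525 = Bremner p. 131 = Schrijver p. 168). Let `L` be the lattice of
rank `n + 1` with basis `e₁, …, eₙ`, `(y₁, …, yₙ, c₀)`, `c₀ = 2^{-n(n+1)/4} ε^{n+1}`; `d(L) = c₀`. The
first vector `b₁` of an LLL-reduced basis satisfies `‖b₁‖ ≤ 2^{n/4} d(L)^{1/(n+1)} = ε`
(Prop. 1.6 (1.9)); writing `b₁ = (q y₁ - p₁, …, q yₙ - pₙ, q c₀)` with integers `pᵢ, q` gives
`|q yᵢ - pᵢ| ≤ ε` and `|q| ≤ ε/c₀ = 2^{n(n+1)/4} ε⁻ⁿ`; `q ≠ 0` since `ε < 1` and `b₁ ≠ 0`; replace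
`b₁` by `-b₁` if `q < 0`.

**The proof given here** follows this architecture with ONE deviation, forced by the tree's LLL
machine (`LLLMachineMain.lllMachineF`, LLL82 Prop. 1.26, which reduces INTEGER bases; LLL82 Remark 1.37
and Schrijver Thm. 6.4 reduce the rational Gram matrix instead, the corner `c₀` being irrational for
`n ≡ 1, 2 (mod 4)` — Bremner p. 130: "the entry in the upper left corner may not be rational"): the
corner `c₀ = ε/Q₀`, `Q₀ = 2^{n(n+1)/4} ε⁻ⁿ`, is replaced by the rational `c = ε/M` with the integer
`M = ⌊Q₀⌋ + 1`, computed exactly with integer square roots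
(`M = ⌊√⌊√((2^{n+1} b⁴)ⁿ)⌋⌋ / aⁿ + 1` for `ε = a/b`; `SimApproxLLL.bigM`, `SimApproxLLL.bigM_eq`).
Since `Q₀ < M ≤ Q₀ + 1` (`SimApproxLLL.lt_sq_bigM`, `SimApproxLLL.sq_bigM_pred_le`, squared and cleared
of denominators), (1.9) gives `‖b₁‖ < ε` STRICTLY, hence `|q| < ε/c = M`, i.e. `|q| ≤ M - 1 = ⌊Q₀⌋ ≤ Q₀`:
exactly the printed bound. The lattice is scaled by `K = bMV` (`V = ∏ den(yᵢ)`) to the integer basis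
`K e₁, …, K eₙ, (K y₁, …, K yₙ, aV)` (`SimApproxLLL.inst`, lower triangular, `det = Kⁿ aV`,
`SimApproxLLL.det_inst`), and (1.9) is used in the form `‖b₁‖^{2(n+1)} ≤ 2^{n(n+1)/2} d²`
(`SimApproxLLL.pow_norm_vec_zero_le`, from the tree theorems `IsLLLReduced.sq_norm_zero_le_two_pow_mul_holds`
(1.7) and `covolume_latticeOfBasis_eq_prod_norm_gramSchmidt`), so that only the final comparison with
`Q₀` involves a real exponent.

* `SimApproxLLL.approx` — the function; `SimApproxLLL.approx_polyTime` — it is polynomial-time for the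
  encodings of the fact, assembled in the typed `CodeFP` algebra (`CodeFP*.lean`, `AOWListMatrixFP.tabFP`,
  `LatticeTableCodeFP.latticeTableFP`, and `CodeFP.of_fn lllMachineF` for the LLL stage);
* `SimApproxLLL.lllOut_spec` — the machine returns an LLL-reduced basis of the same lattice
  (`exists_lllMachineF_encode_eq`); `SimApproxLLL.norm_row_lt` — `‖b₁‖ < Kε`;
  `SimApproxLLL.exists_coeffs`, `SimApproxLLL.pRaw_getElem` — reading `q, pᵢ` off `b₁`;
  `SimApproxLLL.approx_spec` — the four clauses; `LLL1982_prop_1_39_holds`.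

## References

* A. K. Lenstra, H. W. Lenstra Jr., L. Lovász, *Factoring polynomials with rational coefficients*,
  Math. Ann. 261 (1982) 515–534, Prop. 1.39 (and Prop. 1.6 (1.9), Prop. 1.26, Remark 1.37)
  [LenstraLenstraLovasz1982].
* M. R. Bremner, *Lattice Basis Reduction*, CRC Press 2011, §9.2, Prop. 9.4 [Bremner2011].
* A. Schrijver, *Theory of Linear and Integer Programming*, Wiley 1986, §6.3, Cor. 6.4c.
* S. Arora, B. Barak, *Computational Complexity: A Modern Approach*, CUP 2009, §1.3 (polynomial time is
  closed under composition) [AroraBarak2009].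
-/

noncomputable section

namespace Literature.Algebra.EuclideanLattices

open _root_.Computability Literature.Computability.Complexity Literature.Computability.Complexity.CodeFP
  Literature.Computability.Complexity.LMat InnerProductSpace

namespace SimApproxLLL

/-! ### The data of the algorithm -/

/-- `V = ∏ᵢ den(yᵢ)`, a common denominator of the `yᵢ`. [folklore] -/
def denProd (y : List ℚ) : ℕ := (y.map Rat.den).prod

/-- `M = ⌊2^{n(n+1)/4} (b/a)ⁿ⌋ + 1`, computed with integer square roots:
`⌊√⌊√((2^{n+1} b⁴)ⁿ)⌋⌋ / aⁿ + 1` (the inner root is exact, `(2^{n+1}b⁴)ⁿ = (2^{n(n+1)/2} b^{2n})²`). [folklore] -/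
def bigM (n a b : ℕ) : ℕ := Nat.sqrt (Nat.sqrt ((2 ^ (n + 1) * b ^ 4) ^ n)) / a ^ n + 1

/-- The integer scaling factor `K = b · M · V` (`ε = a/b`). [folklore] -/
def scale (y : List ℚ) (ε : ℚ) : ℕ := ε.den * bigM y.length ε.num.natAbs ε.den * denProd y

/-- The integers `K yᵢ` (exact divisions: `den(yᵢ) ∣ V ∣ K`). [folklore] -/
def scaledNums (y : List ℚ) (ε : ℚ) : List ℤ := y.map fun t => (scale y ε : ℤ) * t.num / (t.den : ℤ)

/-- The corner entry `a V = K · (ε / M)`. [folklore] -/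
def corner (y : List ℚ) (ε : ℚ) : ℤ := ε.num * (denProd y : ℤ)

/-- The context `((K, (K yᵢ)ᵢ), (aV, n))` from which the basis matrix is tabulated. [folklore] -/
def ctx (y : List ℚ) (ε : ℚ) : (ℤ × List ℤ) × (ℤ × ℕ) := (((scale y ε : ℤ), scaledNums y ε), (corner y ε, y.length))

/-- Entry `(i, j)` of the basis matrix from the context: rows `i < n` are `K eᵢ`, row `n` is
`(K y₀, …, K yₙ₋₁, aV)`. [cite: LenstraLenstraLovasz1982, proof of Prop. 1.39] -/
def entryOf (c : (ℤ × List ℤ) × (ℤ × ℕ)) (ij : ℕ × ℕ) : ℤ :=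
  if ij.1 < c.2.2 then (if ij.2 = ij.1 then c.1.1 else 0)
  else (if ij.2 < c.2.2 then c.1.2.getD ij.2 0 else c.2.1)

/-- The basis matrix as a list table. [cite: LenstraLenstraLovasz1982, proof of Prop. 1.39] -/
def rows (y : List ℚ) (ε : ℚ) : List (List ℤ) :=
  tab (y.length + 1) (y.length + 1) fun i j => entryOf (ctx y ε) (i, j)

/-- The integer lattice instance `⟨n + 1, B⟩` handed to LLL. [cite: LenstraLenstraLovasz1982, proof of Prop. 1.39] -/
def inst (y : List ℚ) (ε : ℚ) : LatticeInstance :=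
  ⟨y.length + 1, toMat (y.length + 1) (y.length + 1) (rows y ε)⟩

/-- The function computed by the tree's LLL machine `lllMachineF` on every instance (the saturated
run, `lllMachineF_encode`); on nonsingular instances it is `LatticeInstance.lllReduce`.
[cite: LenstraLenstraLovasz1982, Prop. 1.26] -/
def lllOut (I : LatticeInstance) : LatticeInstance :=
  ⟨I.n, ((capStep (lllBudget I.encode.length))^[lllBudget I.encode.length] (lllStart I.basis)).b⟩

/-- The entries of an instance in row-major order (the list coded by `LatticeInstance.encode`). [folklore] -/
def flatOf (I : LatticeInstance) : List ℤ :=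
  List.ofFn fun m : Fin (I.n * I.n) => I.basis (finProdFinEquiv.symm m).1 (finProdFinEquiv.symm m).2

/-- The first row `w` of the reduced basis. [cite: LenstraLenstraLovasz1982, proof of Prop. 1.39] -/
def firstRow (y : List ℚ) (ε : ℚ) : List ℤ := (flatOf (lllOut (inst y ε))).take (y.length + 1)

/-- `q' = wₙ / (aV)`. [cite: LenstraLenstraLovasz1982, proof of Prop. 1.39] -/
def qRaw (y : List ℚ) (ε : ℚ) : ℤ := (firstRow y ε).getD y.length 0 / corner y ε

/-- `p'ᵢ = (q' K yᵢ - wᵢ) / K`. [cite: LenstraLenstraLovasz1982, proof of Prop. 1.39] -/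
def pRaw (y : List ℚ) (ε : ℚ) : List ℤ :=
  List.zipWith (fun ky w => (qRaw y ε * ky - w) / (scale y ε : ℤ)) (scaledNums y ε) (firstRow y ε)

/-- The sign of `q'` (`-1` if negative, else `1`). [cite: LenstraLenstraLovasz1982, proof of Prop. 1.39] -/
def sgn (y : List ℚ) (ε : ℚ) : ℤ := if qRaw y ε < 0 then -1 else 1

/-- **The approximation function** `(y, ε) ↦ (p, q)`. [cite: LenstraLenstraLovasz1982, Prop. 1.39] -/
def approx (p : List ℚ × ℚ) : List ℤ × ℕ :=
  ((pRaw p.1 p.2).map fun z => sgn p.1 p.2 * z, (sgn p.1 p.2 * qRaw p.1 p.2).toNat)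

/-! ### The machine: the approximation function is polynomial-time (typed `CodeFP` algebra) -/

/-- The code of a rational: `⟨smE num, bin den⟩` (this is `encodingRatBool.encode`, `ratE_eq`). [folklore] -/
def ratE : ℚ → List Bool := fun q => boolPair (smE q.num) (natE q.den)

/-- `encodingRatBool` codes by `ratE`. [folklore] -/
theorem ratE_eq : (encodingRatBool.encode : ℚ → List Bool) = ratE := rfl

/-- Unfolding of `ratE` as a pair code. [folklore] -/
theorem ratE_apply (q : ℚ) : ratE q = pairE smE natE (q.num, q.den) := rfl

/-- The input code. [folklore] -/
abbrev inE : List ℚ × ℚ → List Bool := pairE (listE ratE) ratE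

/-- A rational is coded by the pair (numerator in sign–magnitude, denominator in binary). [folklore] -/
theorem numDenFP : CodeFP ratE (pairE intE natE) (fun q => (q.num, q.den)) := by
  have t1 : CodeFP ratE (pairE smE natE) (fun q => (q.num, q.den)) := CodeFP.transparent fun q => (ratE_apply q).symm
  have t2 : CodeFP (pairE smE natE) (pairE intE natE) (fun p => (p.1, p.2)) :=
    ((intOfSM.comp (fst smE natE)).pair (snd smE natE) :)
  exact (t2.comp t1 :)

/-- The list `y` (raw). [folklore] -/
theorem yFP : CodeFP inE (rawE ratE) (fun p => p.1) := ((rawOfList ratE).comp (fst _ _) :)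

/-- `n = |y|` in unary. [folklore] -/
theorem nFP : CodeFP inE unE (fun p => p.1.length) := ((ulength ratE).comp yFP :)

/-- `num ε`. [folklore] -/
theorem numFP : CodeFP inE intE (fun p => p.2.num) := ((numDenFP.comp (snd _ _)).fst' :)

/-- `den ε`. [folklore] -/
theorem denFP : CodeFP inE natE (fun p => p.2.den) := ((numDenFP.comp (snd _ _)).snd' :)

/-- Products of lists of numerals (`Brick.prodListFn`). [folklore] -/
theorem prodFP : CodeFP (rawE natE) natE List.prod := by
  have h : CodeFP (pairE CodeFP.unitE (rawE natE)) natE (fun p => p.2.prod) :=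
    of_fn Brick.prodListFn Brick.prodListFn_mem_FP fun p => by
      rw [pairE_apply, Brick.prodListFn_boolPair, decNil_rawE, List.map_map]
      congr 1
      refine congrArg List.prod ?_
      rw [List.map_congr_left (fun a _ => ?_), List.map_id]
      exact bitsToNat_natE a
  exact (h.comp ((const (rawE natE) ()).pair (CodeFP.id _))).congr fun _ => rfl

/-- `V`. [folklore] -/
theorem denProdFP : CodeFP inE natE (fun p => denProd p.1) :=
  (prodFP.comp ((map₀ numDenFP.snd').comp yFP)).congr fun _ => rfl

/-- `M`. [folklore] -/
theorem bigMFP : CodeFP inE natE (fun p => bigM p.1.length p.2.num.natAbs p.2.den) := by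
  have ha : CodeFP inE natE (fun p => p.2.num.natAbs) := (intNatAbs.comp numFP :)
  have h2 : CodeFP inE natE (fun p => 2 ^ (p.1.length + 1)) := (natPow.comp ((const inE 2).pair (unSucc.comp nFP)) :)
  have hb4 : CodeFP inE natE (fun p => p.2.den ^ 4) := (natPow.comp (denFP.pair (const inE 4)) :)
  have hT : CodeFP inE natE (fun p => (2 ^ (p.1.length + 1) * p.2.den ^ 4) ^ p.1.length) :=
    (natPow.comp ((natMul.comp (h2.pair hb4)).pair nFP) :)
  have hs : CodeFP inE natE (fun p => Nat.sqrt (Nat.sqrt ((2 ^ (p.1.length + 1) * p.2.den ^ 4) ^ p.1.length))) :=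
    (natSqrt.comp (natSqrt.comp hT) :)
  have han : CodeFP inE natE (fun p => p.2.num.natAbs ^ p.1.length) := (natPow.comp (ha.pair nFP) :)
  exact (natAdd.comp ((natDiv.comp (hs.pair han)).pair (const inE 1))).congr fun _ => rfl

/-- `K`. [folklore] -/
theorem scaleFP : CodeFP inE natE (fun p => scale p.1 p.2) :=
  (natMul.comp ((natMul.comp (denFP.pair bigMFP)).pair denProdFP)).congr fun _ => rfl

/-- `K` as an integer. [folklore] -/
theorem scaleZFP : CodeFP inE intE (fun p => (scale p.1 p.2 : ℤ)) := (intOfNat.comp scaleFP :)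

/-- `(K yᵢ)ᵢ`. [folklore] -/
theorem scaledNumsFP : CodeFP inE (rawE intE) (fun p => scaledNums p.1 p.2) := by
  have hg : CodeFP (pairE intE ratE) intE (fun c => c.1 * c.2.num / (c.2.den : ℤ)) :=
    (intEDiv.comp ((intMul.comp ((fst _ _).pair (numDenFP.comp (snd _ _)).fst')).pair
      (intOfNat.comp (numDenFP.comp (snd _ _)).snd')) :)
  exact ((map hg).comp (scaleZFP.pair yFP)).congr fun _ => rfl

/-- `aV`. [folklore] -/
theorem cornerFP : CodeFP inE intE (fun p => corner p.1 p.2) :=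
  (intMul.comp (numFP.pair (intOfNat.comp denProdFP))).congr fun _ => rfl

/-- The code of the context. [folklore] -/
abbrev ctxE : (ℤ × List ℤ) × (ℤ × ℕ) → List Bool := pairE (pairE intE (rawE intE)) (pairE intE natE)

/-- The context. [folklore] -/
theorem ctxFP : CodeFP inE ctxE (fun p => ctx p.1 p.2) :=
  ((scaleZFP.pair scaledNumsFP).pair (cornerFP.pair (natOfUn.comp nFP))).congr fun _ => rfl

/-- The entry function on codes. [folklore] -/
theorem entryOfFP : CodeFP (pairE ctxE (pairE natE natE)) intE (fun t => entryOf t.1 t.2) := by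
  have hi : CodeFP (pairE ctxE (pairE natE natE)) natE (fun t => t.2.1) := ((snd _ _).fst' :)
  have hj : CodeFP (pairE ctxE (pairE natE natE)) natE (fun t => t.2.2) := ((snd _ _).snd' :)
  have hn : CodeFP (pairE ctxE (pairE natE natE)) natE (fun t => t.1.2.2) := ((fst _ _).snd'.snd' :)
  have hK : CodeFP (pairE ctxE (pairE natE natE)) intE (fun t => t.1.1.1) := ((fst _ _).fst'.fst' :)
  have hc : CodeFP (pairE ctxE (pairE natE natE)) intE (fun t => t.1.2.1) := ((fst _ _).snd'.fst' :)
  have hl : CodeFP (pairE ctxE (pairE natE natE)) (rawE intE) (fun t => t.1.1.2) := ((fst _ _).fst'.snd' :)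
  have hget : CodeFP (pairE ctxE (pairE natE natE)) intE (fun t => t.1.1.2.getD t.2.2 0) :=
    ((rawGetOr intE).comp (hl.pair (hj.pair (const _ (0 : ℤ)))) :)
  have h := (natLt.comp (hi.pair hn)).ite ((natEq.comp (hj.pair hi)).ite hK (const _ (0 : ℤ)))
    ((natLt.comp (hj.pair hn)).ite hget hc)
  refine h.congr fun t => ?_
  simp only [entryOf, decide_eq_true_eq]

/-- The table. [folklore] -/
theorem rowsFP : CodeFP inE matE (fun p => rows p.1 p.2) :=
  ((tabFP entryOfFP).comp (ctxFP.pair ((unSucc.comp nFP).pair (unSucc.comp nFP)))).congr fun _ => rfl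

/-- The code of the instance. [folklore] -/
theorem instFP : CodeFP inE LatticeInstance.encode (fun p => inst p.1 p.2) :=
  ((latticeTableFP.comp ((unSucc.comp nFP).pair rowsFP)).recodeOut fun _ => rfl :)

/-- **The LLL stage**: `lllOut` is computed on codes by `lllMachineF`. [cite: LenstraLenstraLovasz1982, Prop. 1.26] -/
theorem lllOutFP : CodeFP LatticeInstance.encode LatticeInstance.encode lllOut :=
  of_fn LLLMachine.lllMachineF LLLMachine.lllMachineF_mem_FP fun I => LLLMachine.lllMachineF_encode I

/-- The code of an instance, read as the record `⟨bin n, listE smE (entries)⟩`. [folklore] -/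
theorem flatFP : CodeFP LatticeInstance.encode (pairE natE (listE smE)) (fun I => (I.n, flatOf I)) :=
  (CodeFP.id LatticeInstance.encode).recodeOut fun I => latticeInstance_encode_eq I.n I.basis

/-- The first row of the reduced basis. [folklore] -/
theorem firstRowFP : CodeFP inE (rawE intE) (fun p => firstRow p.1 p.2) := by
  have h1 : CodeFP inE (rawE smE) (fun p => flatOf (lllOut (inst p.1 p.2))) :=
    ((rawOfList smE).comp (flatFP.comp (lllOutFP.comp instFP)).snd' :)
  have h2 : CodeFP inE (rawE smE) (fun p => firstRow p.1 p.2) :=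
    ((rawTakeUn smE).comp ((unSucc.comp nFP).pair h1)).congr fun _ => rfl
  exact ((map₀ intOfSM).comp h2).congr fun _ => by simp

/-- `q'`. [folklore] -/
theorem qRawFP : CodeFP inE intE (fun p => qRaw p.1 p.2) :=
  (intEDiv.comp (((rawGetOr intE).comp (firstRowFP.pair ((natOfUn.comp nFP).pair (const inE (0 : ℤ))))).pair
    cornerFP)).congr fun _ => rfl

/-- `p'`. [folklore] -/
theorem pRawFP : CodeFP inE (rawE intE) (fun p => pRaw p.1 p.2) := by
  have hg : CodeFP (pairE (pairE intE intE) (pairE intE intE)) intE (fun t => (t.1.1 * t.2.1 - t.2.2) / t.1.2) :=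
    (intEDiv.comp ((intSub.comp ((intMul.comp ((fst _ _).fst'.pair (snd _ _).fst')).pair (snd _ _).snd')).pair
      (fst _ _).snd') :)
  exact ((zipWith hg).comp ((qRawFP.pair scaleZFP).pair (scaledNumsFP.pair firstRowFP))).congr fun _ => rfl

/-- The sign. [folklore] -/
theorem sgnFP : CodeFP inE intE (fun p => sgn p.1 p.2) :=
  ((intLt.comp (qRawFP.pair (const inE (0 : ℤ)))).ite (const inE (-1 : ℤ)) (const inE (1 : ℤ))).congr fun p => by
    simp only [sgn, decide_eq_true_eq]

/-- **The approximation function is computed on codes in polynomial time.** [cite: LenstraLenstraLovasz1982, Prop. 1.39] -/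
theorem approxFP : CodeFP inE (pairE (listE smE) natE) approx := by
  have h1 : CodeFP inE (rawE intE) (fun p => (pRaw p.1 p.2).map fun z => sgn p.1 p.2 * z) :=
    ((map intMul).comp (sgnFP.pair pRawFP) :)
  have h1' : CodeFP inE (listE smE) (fun p => (pRaw p.1 p.2).map fun z => sgn p.1 p.2 * z) :=
    ((listOfRaw smE).comp ((map₀ smOfInt).comp h1)).congr fun _ => by simp
  have h2 : CodeFP inE natE (fun p => (sgn p.1 p.2 * qRaw p.1 p.2).toNat) :=
    (intToNat.comp (intMul.comp (sgnFP.pair qRawFP)) :)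
  exact (h1'.pair h2).congr fun _ => rfl

/-- **`approx` is polynomial-time computable for the encodings of the fact.** [cite: LenstraLenstraLovasz1982, Prop. 1.39] -/
theorem approx_polyTime :
    PolyTimeComputable simApproxInputEncoding.encode simApproxOutputEncoding.encode approx := by
  have h := approxFP.polyTimeComputable
  have e1 : (simApproxInputEncoding.encode : List ℚ × ℚ → List Bool) = inE := by
    rw [simApproxInputEncoding, pairE_eq, listE_eq, ratE_eq]
  have e2 : (simApproxOutputEncoding.encode : List ℤ × ℕ → List Bool) = pairE (listE smE) natE := by
    rw [simApproxOutputEncoding, pairE_eq, listE_eq]; rfl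
  rw [e1, e2]
  exact h

/-! ### The basis matrix: entries, determinant, nonsingularity -/

section Math

variable (y : List ℚ) (ε : ℚ)

/-- Entries of the basis matrix. [folklore] -/
theorem inst_basis_apply (i j : Fin (y.length + 1)) :
    (inst y ε).basis i j = entryOf (ctx y ε) ((i : ℕ), (j : ℕ)) := by
  show toMat _ _ (tab _ _ _) i j = _
  rw [toMat_tab]

/-- Upper-left block: `K · 1`. [folklore] -/
theorem basis_castSucc_castSucc (i j : Fin y.length) :
    (inst y ε).basis i.castSucc j.castSucc = if j = i then (scale y ε : ℤ) else 0 := by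
  rw [inst_basis_apply]
  simp [entryOf, ctx, Fin.ext_iff]

/-- Last column above the corner: `0`. [folklore] -/
theorem basis_castSucc_last (i : Fin y.length) : (inst y ε).basis i.castSucc (Fin.last _) = 0 := by
  rw [inst_basis_apply]
  simp only [entryOf, ctx, Fin.val_castSucc, Fin.val_last, Fin.is_lt, if_true]
  rw [if_neg (by have := i.is_lt; omega)]

/-- Last row: `K yⱼ`. [folklore] -/
theorem basis_last_castSucc (j : Fin y.length) :
    (inst y ε).basis (Fin.last _) j.castSucc = (scaledNums y ε).getD j 0 := by
  rw [inst_basis_apply]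
  simp [entryOf, ctx]

/-- The corner: `aV`. [folklore] -/
theorem basis_last_last : (inst y ε).basis (Fin.last _) (Fin.last _) = corner y ε := by
  rw [inst_basis_apply]
  simp [entryOf, ctx]

/-- The basis matrix is lower triangular. [folklore] -/
theorem inst_blockTriangular : (inst y ε).basis.BlockTriangular ⇑OrderDual.toDual := by
  intro i j hij
  rw [OrderDual.toDual_lt_toDual, Fin.lt_def] at hij
  rw [inst_basis_apply]
  have hj : (j : ℕ) < y.length + 1 := j.is_lt
  simp only [entryOf, ctx]
  rw [if_pos (by omega), if_neg (by omega)]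

/-- **`det B = Kⁿ · aV`.** [folklore] -/
theorem det_inst : (inst y ε).basis.det = (scale y ε : ℤ) ^ y.length * corner y ε := by
  rw [Matrix.det_of_lowerTriangular _ (inst_blockTriangular y ε)]
  show ∏ i : Fin (y.length + 1), (inst y ε).basis i i = _
  rw [Fin.prod_univ_castSucc]
  simp [basis_castSucc_castSucc, basis_last_last]

/-- `V ≥ 1`. [folklore] -/
theorem denProd_pos : 0 < denProd y := by
  unfold denProd
  apply List.prod_pos
  intro a ha
  obtain ⟨t, -, rfl⟩ := List.mem_map.1 ha
  exact t.den_pos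

/-- `M ≥ 1`. [folklore] -/
theorem bigM_pos (n a b : ℕ) : 0 < bigM n a b := Nat.succ_pos _

variable {y ε}

/-- `K ≥ 1`. [folklore] -/
theorem scale_pos : 0 < scale y ε :=
  Nat.mul_pos (Nat.mul_pos ε.den_pos (bigM_pos _ _ _)) (denProd_pos y)

/-- `aV > 0` for `ε > 0`. [folklore] -/
theorem corner_pos (hε : 0 < ε) : 0 < corner y ε :=
  mul_pos (Rat.num_pos.2 hε) (by exact_mod_cast denProd_pos y)

/-- **The instance is nonsingular** for `ε > 0`. [folklore] -/
theorem inst_isNonsingular (hε : 0 < ε) : (inst y ε).IsNonsingular := by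
  rw [LatticeInstance.isNonsingular_iff, det_inst]
  exact mul_ne_zero (pow_ne_zero _ (by exact_mod_cast scale_pos.ne')) (corner_pos hε).ne'

/-- `den(yⱼ) ∣ K`. [folklore] -/
theorem den_dvd_scale {t : ℚ} (ht : t ∈ y) : t.den ∣ scale y ε :=
  Dvd.dvd.mul_left (List.dvd_prod (List.mem_map.2 ⟨t, ht, rfl⟩)) _

/-- The `j`-th scaled numerator is `K yⱼ`, exactly. [folklore] -/
theorem scaledNums_getD (j : Fin y.length) :
    (((scaledNums y ε).getD j 0 : ℤ) : ℚ) = (scale y ε : ℚ) * y.get j := by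
  have hj : (j : ℕ) < (scaledNums y ε).length := by simp [scaledNums]
  rw [List.getD_eq_getElem _ _ hj]
  simp only [scaledNums, List.getElem_map]
  set t := y[(j : ℕ)] with ht
  have hmem : t ∈ y := List.getElem_mem _
  have hdvd : (t.den : ℤ) ∣ (scale y ε : ℤ) * t.num :=
    Dvd.dvd.mul_right (Int.natCast_dvd_natCast.2 (den_dvd_scale hmem)) _
  rw [Int.cast_div hdvd (by exact_mod_cast t.den_ne_zero), List.get_eq_getElem, ← ht]
  push_cast
  rw [mul_div_assoc, Rat.num_div_den]

/-- Coefficients times the basis, last coordinate: `z ᵥ* B` at `n` is `zₙ · aV`. [folklore] -/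
theorem vecMul_inst_last (z : Fin (y.length + 1) → ℤ) :
    Matrix.vecMul z (inst y ε).basis (Fin.last _) = z (Fin.last _) * corner y ε := by
  simp [Matrix.vecMul, dotProduct, Fin.sum_univ_castSucc, basis_castSucc_last, basis_last_last]

/-- Coefficients times the basis, coordinate `j < n`: `zⱼ K + zₙ (K yⱼ)`. [folklore] -/
theorem vecMul_inst_castSucc (z : Fin (y.length + 1) → ℤ) (j : Fin y.length) :
    Matrix.vecMul z (inst y ε).basis j.castSucc =
      z j.castSucc * (scale y ε : ℤ) + z (Fin.last _) * (scaledNums y ε).getD j 0 := by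
  simp [Matrix.vecMul, dotProduct, Fin.sum_univ_castSucc, basis_castSucc_castSucc, basis_last_castSucc]

/-! ### The LLL stage: reduced basis of the same lattice -/

/-- **On a nonsingular instance the machine returns a reduced basis of the same lattice**
(`exists_lllMachineF_encode_eq`, injectivity of the code). [cite: LenstraLenstraLovasz1982, Prop. 1.26] -/
theorem lllOut_spec {I : LatticeInstance} (hI : I.IsNonsingular) :
    (lllOut I).lattice = I.lattice ∧ IsLLLReduced (3 / 4) (lllOut I).vec := by
  obtain ⟨B', hcode, hlat, hred⟩ := exists_lllMachineF_encode_eq hI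
  have h : (⟨I.n, B'⟩ : LatticeInstance) = lllOut I :=
    LatticeInstance.encode_injective (hcode.symm.trans (LLLMachine.lllMachineF_encode I))
  obtain rfl : B' = ((capStep (lllBudget I.encode.length))^[lllBudget I.encode.length] (lllStart I.basis)).b :=
    eq_of_heq (LatticeInstance.mk.inj h).2
  exact ⟨hlat, hred⟩

/-- The reduced instance is nonsingular. [folklore] -/
theorem lllOut_isNonsingular {I : LatticeInstance} (hI : I.IsNonsingular) : (lllOut I).IsNonsingular :=
  LatticeInstance.isNonsingular_of_lattice_eq hI (lllOut_spec hI).1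

/-! ### LLL82 (1.7)/(1.9) for an integer instance: `‖b₀‖^{2n} ≤ 2^{n(n-1)/2} d(L)²` -/

/-- A coordinate is at most the Euclidean norm. [folklore] -/
theorem abs_apply_le_norm' {m : ℕ} (x : EuclideanSpace ℝ (Fin m)) (i : Fin m) : |x i| ≤ ‖x‖ := by
  rw [EuclideanSpace.norm_eq]
  have hi : ‖x i‖ ^ 2 ≤ ∑ j, ‖x j‖ ^ 2 := Finset.single_le_sum (fun j _ => sq_nonneg ‖x j‖) (Finset.mem_univ i)
  calc |x i| = √(‖x i‖ ^ 2) := by rw [Real.sqrt_sq (norm_nonneg _), Real.norm_eq_abs]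
    _ ≤ √(∑ j, ‖x j‖ ^ 2) := Real.sqrt_le_sqrt hi

/-- **LLL82 (1.9) with natural exponents**: for a nonsingular integer instance of dimension `n ≥ 1`
with LLL-reduced rows, `‖b₀‖^{2n} ≤ 2^{∑_{i<n} i} d(L)²` (from (1.7), `‖b₀‖² ≤ 2^i ‖b*ᵢ‖²`, and
`d(L) = ∏ ‖b*ᵢ‖`). [cite: LenstraLenstraLovasz1982, Prop. 1.6 (1.7), (1.9)] -/
theorem pow_norm_vec_zero_le {I : LatticeInstance} (hI : I.IsNonsingular) (hn : 0 < I.n)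
    (hred : IsLLLReduced (3 / 4) I.vec) :
    ‖I.vec ⟨0, hn⟩‖ ^ (2 * I.n) ≤ 2 ^ (∑ i ∈ Finset.range I.n, i) * ZLattice.covolume I.lattice ^ 2 := by
  have hcov : ZLattice.covolume I.lattice = ∏ i, ‖gramSchmidt ℝ I.vec i‖ := by
    have h := covolume_latticeOfBasis_eq_prod_norm_gramSchmidt (LatticeInstance.basisOfIsNonsingular hI)
    dsimp only [Literature.Computability.Cryptography.latticeOfBasis] at h
    rw [← LatticeInstance.lattice_eq_span_basisOfIsNonsingular hI, LatticeInstance.coe_basisOfIsNonsingular] at h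
    exact h
  have h17 := fun i => IsLLLReduced.sq_norm_zero_le_two_pow_mul_holds hred i hn
  calc ‖I.vec ⟨0, hn⟩‖ ^ (2 * I.n) = ∏ _i : Fin I.n, ‖I.vec ⟨0, hn⟩‖ ^ 2 := by
        rw [Finset.prod_const, Finset.card_univ, Fintype.card_fin, pow_mul]
    _ ≤ ∏ i : Fin I.n, 2 ^ (i : ℕ) * ‖gramSchmidt ℝ I.vec i‖ ^ 2 :=
        Finset.prod_le_prod (fun i _ => by positivity) fun i _ => h17 i
    _ = 2 ^ (∑ i ∈ Finset.range I.n, i) * ZLattice.covolume I.lattice ^ 2 := by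
        rw [Finset.prod_mul_distrib, Finset.prod_pow_eq_pow_sum, Finset.prod_pow, ← hcov,
          Fin.sum_univ_eq_sum_range (fun i => i) I.n]
  exact le_rfl

end Math

/-! ### The integer square roots: `Q₀ < M ≤ Q₀ + 1` in squared, integral form -/

section Roots

/-- `∑_{i ≤ n} i` doubled is `(n + 1) n`. [folklore] -/
theorem sum_range_succ_mul_two (n : ℕ) : (∑ i ∈ Finset.range (n + 1), i) * 2 = (n + 1) * n := by
  rw [Finset.sum_range_id_mul_two]; rfl

/-- The inner root is exact: `⌊√((2^{n+1} b⁴)ⁿ)⌋ = 2^{n(n+1)/2} b^{2n}`. [folklore] -/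
theorem sqrt_inner_eq (n b : ℕ) :
    Nat.sqrt ((2 ^ (n + 1) * b ^ 4) ^ n) = 2 ^ (∑ i ∈ Finset.range (n + 1), i) * b ^ (2 * n) := by
  set N := ∑ i ∈ Finset.range (n + 1), i with hN
  have e1 : (2 : ℕ) ^ N * 2 ^ N = 2 ^ ((n + 1) * n) := by rw [← pow_add, ← mul_two, sum_range_succ_mul_two]
  have h : (2 ^ (n + 1) * b ^ 4) ^ n = (2 ^ N * b ^ (2 * n)) * (2 ^ N * b ^ (2 * n)) := by
    calc (2 ^ (n + 1) * b ^ 4) ^ n = 2 ^ ((n + 1) * n) * (b ^ (2 * n) * b ^ (2 * n)) := by ring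
      _ = (2 ^ N * b ^ (2 * n)) * (2 ^ N * b ^ (2 * n)) := by rw [← e1]; ring
  rw [h, Nat.sqrt_eq]

/-- `M = ⌊√(2^{n(n+1)/2} b^{2n})⌋ / aⁿ + 1`. [folklore] -/
theorem bigM_eq (n a b : ℕ) :
    bigM n a b = Nat.sqrt (2 ^ (∑ i ∈ Finset.range (n + 1), i) * b ^ (2 * n)) / a ^ n + 1 := by
  rw [bigM, sqrt_inner_eq]

/-- **`Q₀ < M`, squared and cleared of denominators**: `2^{n(n+1)/2} b^{2n} < (aⁿ M)²`. [folklore] -/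
theorem lt_sq_bigM (n b : ℕ) {a : ℕ} (ha : 0 < a) :
    2 ^ (∑ i ∈ Finset.range (n + 1), i) * b ^ (2 * n) < (a ^ n * bigM n a b) ^ 2 := by
  rw [bigM_eq]
  set S := 2 ^ (∑ i ∈ Finset.range (n + 1), i) * b ^ (2 * n)
  set s := Nat.sqrt S
  have han : 0 < a ^ n := pow_pos ha n
  have h1 : S < (s + 1) * (s + 1) := Nat.lt_succ_sqrt S
  have h2 : s + 1 ≤ a ^ n * (s / a ^ n + 1) := by
    have := Nat.lt_div_mul_add (a := s) han
    rw [mul_add, mul_one, mul_comm]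
    omega
  calc S < (s + 1) * (s + 1) := h1
    _ ≤ (a ^ n * (s / a ^ n + 1)) * (a ^ n * (s / a ^ n + 1)) := Nat.mul_le_mul h2 h2
    _ = (a ^ n * (s / a ^ n + 1)) ^ 2 := (pow_two _).symm

/-- **`M - 1 ≤ Q₀`, squared and cleared of denominators**: `((M - 1) aⁿ)² ≤ 2^{n(n+1)/2} b^{2n}`. [folklore] -/
theorem sq_bigM_pred_le (n a b : ℕ) :
    ((bigM n a b - 1) * a ^ n) ^ 2 ≤ 2 ^ (∑ i ∈ Finset.range (n + 1), i) * b ^ (2 * n) := by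
  rw [bigM_eq, Nat.add_sub_cancel]
  set S := 2 ^ (∑ i ∈ Finset.range (n + 1), i) * b ^ (2 * n)
  calc (Nat.sqrt S / a ^ n * a ^ n) ^ 2 ≤ (Nat.sqrt S) ^ 2 :=
        Nat.pow_le_pow_left (Nat.div_mul_le_self _ _) 2
    _ ≤ S := Nat.sqrt_le' S

end Roots

/-! ### The first row of the reduced basis and the output -/

section Main

variable {y : List ℚ} {ε : ℚ}

/-- The first row has `n + 1` entries. [folklore] -/
theorem length_firstRow (y : List ℚ) (ε : ℚ) : (firstRow y ε).length = y.length + 1 := by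
  simp only [firstRow, flatOf, List.length_take, List.length_ofFn]
  exact Nat.min_eq_left (Nat.le_mul_self _)

/-- The first row, entrywise: `wⱼ = B'₀ⱼ`. [folklore] -/
theorem firstRow_getElem (j : ℕ) (hj : j < (firstRow y ε).length) :
    (firstRow y ε)[j] = (lllOut (inst y ε)).basis ⟨0, Nat.succ_pos _⟩ ⟨j, by rw [length_firstRow] at hj; exact hj⟩ := by
  have hj' : j < y.length + 1 := by rw [length_firstRow] at hj; exact hj
  simp only [firstRow, List.getElem_take, flatOf, List.getElem_ofFn, finProdFinEquiv_symm_apply]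
  congr 1
  · ext
    rw [Fin.coe_divNat]
    exact Nat.div_eq_of_lt hj'
  · ext
    rw [Fin.coe_modNat]
    exact Nat.mod_eq_of_lt hj'

/-- **The first reduced row is an integer combination of the rows of `B`.** [cite: LenstraLenstraLovasz1982, proof of Prop. 1.39] -/
theorem exists_coeffs (hε : 0 < ε) :
    ∃ z : Fin (y.length + 1) → ℤ, Matrix.vecMul z (inst y ε).basis = (lllOut (inst y ε)).basis ⟨0, Nat.succ_pos _⟩ := by
  have hI : (inst y ε).IsNonsingular := inst_isNonsingular hε
  obtain ⟨hlat, -⟩ := lllOut_spec hI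
  have hmem0 : (lllOut (inst y ε)).vec ⟨0, Nat.succ_pos _⟩ ∈ (lllOut (inst y ε)).lattice :=
    Submodule.subset_span ⟨_, rfl⟩
  have hmem : (lllOut (inst y ε)).vec ⟨0, Nat.succ_pos _⟩ ∈ (inst y ε).lattice := by
    rw [hlat] at hmem0
    exact hmem0
  obtain ⟨z, hz⟩ := ((inst y ε).mem_lattice_iff _).1 hmem
  exact ⟨z, intVecToEuclidean_injective (y.length + 1) hz⟩

/-- `K ε = M · aV` (`ε = a/b`, `K = bMV`). [folklore] -/
theorem scale_mul_eps (y : List ℚ) (ε : ℚ) (hε : 0 < ε) :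
    (scale y ε : ℝ) * (ε : ℝ) = (bigM y.length ε.num.natAbs ε.den : ℝ) * (corner y ε : ℝ) := by
  have h1 : ((ε * ε.den : ℚ) : ℝ) = ((ε.num : ℚ) : ℝ) := by rw [Rat.mul_den_eq_num]
  push_cast at h1
  have ha : (ε.num.natAbs : ℤ) = ε.num := Int.natAbs_of_nonneg (Rat.num_nonneg.2 hε.le)
  simp only [scale, corner, Nat.cast_mul, Int.cast_mul, Int.cast_natCast]
  rw [← h1]
  ring

/-- **LLL82 (1.9) for the scaled instance: `‖w‖ < K ε`** — i.e. `‖w‖^{2(n+1)} ≤ 2^{n(n+1)/2} d²`,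
`d = Kⁿ aV`, and `2^{n(n+1)/2} (Kⁿ aV)² < (Kε)^{2(n+1)} = (M aV)^{2(n+1)}` because `Q₀ < M`.
[cite: LenstraLenstraLovasz1982, proof of Prop. 1.39] -/
theorem norm_row_lt (hε : 0 < ε) :
    ‖(lllOut (inst y ε)).vec ⟨0, Nat.succ_pos _⟩‖ < (scale y ε : ℝ) * (ε : ℝ) := by
  have hI : (inst y ε).IsNonsingular := inst_isNonsingular hε
  obtain ⟨hlat, hred⟩ := lllOut_spec hI
  have hI' := lllOut_isNonsingular hI
  have hpow := pow_norm_vec_zero_le hI' (Nat.succ_pos y.length) hred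
  have hcov0 : ZLattice.covolume (lllOut (inst y ε)).lattice = ZLattice.covolume (inst y ε).lattice := by
    have := congrArg (fun L => ZLattice.covolume L) hlat
    exact this
  have hcov : ZLattice.covolume (lllOut (inst y ε)).lattice = (scale y ε : ℝ) ^ y.length * (corner y ε : ℝ) := by
    rw [hcov0, LatticeInstance.covolume_lattice_eq_abs_det hI, ← Int.cast_det, det_inst]
    push_cast
    exact abs_of_pos (mul_pos (pow_pos (by exact_mod_cast scale_pos) _) (by exact_mod_cast corner_pos hε))
  change ‖(lllOut (inst y ε)).vec ⟨0, Nat.succ_pos y.length⟩‖ ^ (2 * (y.length + 1)) ≤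
    2 ^ (∑ i ∈ Finset.range (y.length + 1), i) * ZLattice.covolume (lllOut (inst y ε)).lattice ^ 2 at hpow
  rw [hcov] at hpow
  -- the integral inequality `2^N (bMV)^{2n} (aV)² < (M aV)^{2n+2}` from `2^N b^{2n} < (aⁿ M)²`
  set a := ε.num.natAbs with ha
  set b := ε.den with hb
  set M := bigM y.length a b with hM
  set V := denProd y with hV
  have ha0 : 0 < a := Int.natAbs_pos.2 (Rat.num_pos.2 hε).ne'
  have hV0 : 0 < V := denProd_pos y
  have hM0 : 0 < M := bigM_pos _ _ _
  have key := lt_sq_bigM y.length b ha0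
  have keyN : 2 ^ (∑ i ∈ Finset.range (y.length + 1), i) * (b * M * V) ^ (2 * y.length) * (a * V) ^ 2 <
      (M * (a * V)) ^ (2 * (y.length + 1)) := by
    have hpos : 0 < M ^ (2 * y.length) * V ^ (2 * y.length) * (a * V) ^ 2 := by positivity
    have := Nat.mul_lt_mul_of_pos_right key hpos
    convert this using 1 <;> ring
  have haZ : (a : ℤ) = ε.num := by rw [ha]; exact Int.natAbs_of_nonneg (Rat.num_nonneg.2 hε.le)
  have hcornerR : (corner y ε : ℝ) = (a : ℝ) * (V : ℝ) := by
    have : (ε.num : ℝ) = (a : ℝ) := by rw [← haZ, Int.cast_natCast]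
    simp only [corner, Int.cast_mul, Int.cast_natCast, this, hV]
  have hscaleR : (scale y ε : ℝ) = (b : ℝ) * (M : ℝ) * (V : ℝ) := by simp [scale, hb, hM, hV, ha]
  have hKε : (scale y ε : ℝ) * (ε : ℝ) = (M : ℝ) * ((a : ℝ) * (V : ℝ)) := by
    rw [scale_mul_eps y ε hε, hcornerR]
  have keyR : (2 : ℝ) ^ (∑ i ∈ Finset.range (y.length + 1), i) * ((scale y ε : ℝ) ^ y.length * (corner y ε : ℝ)) ^ 2 <
      ((scale y ε : ℝ) * (ε : ℝ)) ^ (2 * (y.length + 1)) := by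
    rw [hKε, hcornerR, hscaleR]
    have := keyN
    rify at this
    convert this using 1; ring
  have hlt : ‖(lllOut (inst y ε)).vec ⟨0, Nat.succ_pos y.length⟩‖ ^ (2 * (y.length + 1)) < ((scale y ε : ℝ) * (ε : ℝ)) ^ (2 * (y.length + 1)) :=
    hpow.trans_lt keyR
  have hε0 : (0 : ℝ) ≤ (ε : ℝ) := by exact_mod_cast hε.le
  have hKε0 : (0 : ℝ) ≤ (scale y ε : ℝ) * (ε : ℝ) := mul_nonneg (Nat.cast_nonneg _) hε0
  exact lt_of_pow_lt_pow_left₀ (2 * (y.length + 1)) hKε0 hlt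

/-- **`M - 1 ≤ Q₀ = 2^{n(n+1)/4} ε^{-n}`.** [cite: LenstraLenstraLovasz1982, Prop. 1.39] -/
theorem bigM_pred_le (y : List ℚ) (hε : 0 < ε) :
    ((bigM y.length ε.num.natAbs ε.den - 1 : ℕ) : ℝ) ≤
      (2 : ℝ) ^ ((y.length : ℝ) * (y.length + 1) / 4) * ((ε : ℝ)⁻¹) ^ y.length := by
  set n := y.length with hn
  set a := ε.num.natAbs with ha
  set b := ε.den with hb
  set N := ∑ i ∈ Finset.range (n + 1), i with hNdef
  have ha0 : 0 < a := Int.natAbs_pos.2 (Rat.num_pos.2 hε).ne'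
  have haR : (0 : ℝ) < a := by exact_mod_cast ha0
  have hbR : (0 : ℝ) < b := by exact_mod_cast ε.den_pos
  have haZ : (a : ℤ) = ε.num := by rw [ha]; exact Int.natAbs_of_nonneg (Rat.num_nonneg.2 hε.le)
  have hεR : (ε : ℝ) = (a : ℝ) / (b : ℝ) := by
    have h1 : (ε.num : ℝ) = (a : ℝ) := by rw [← haZ, Int.cast_natCast]
    rw [Rat.cast_def, h1]
  have hN : (N : ℝ) * 2 = (n + 1) * n := by exact_mod_cast sum_range_succ_mul_two n
  -- `Q₀² = 2^N (b/a)^{2n}`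
  have hQsq : ((2 : ℝ) ^ ((n : ℝ) * (n + 1) / 4) * ((ε : ℝ)⁻¹) ^ n) ^ 2 = (2 : ℝ) ^ N * ((b : ℝ) / a) ^ (2 * n) := by
    rw [mul_pow, ← Real.rpow_mul_natCast zero_le_two, hεR, inv_div, ← pow_mul, mul_comm n 2]
    congr 1
    rw [show (n : ℝ) * (n + 1) / 4 * ((2 : ℕ) : ℝ) = (N : ℝ) by push_cast; linarith, Real.rpow_natCast]
  have hQ0 : 0 ≤ (2 : ℝ) ^ ((n : ℝ) * (n + 1) / 4) * ((ε : ℝ)⁻¹) ^ n := by positivity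
  refine le_of_pow_le_pow_left₀ two_ne_zero hQ0 ?_
  rw [hQsq]
  have key := sq_bigM_pred_le n a b
  rw [← hNdef] at key
  have keyR : (((bigM n a b - 1 : ℕ) : ℝ) * (a : ℝ) ^ n) ^ 2 ≤ (2 : ℝ) ^ N * (b : ℝ) ^ (2 * n) := by
    exact_mod_cast key
  rw [div_pow, ← mul_div_assoc, le_div_iff₀ (by positivity)]
  calc ((bigM n a b - 1 : ℕ) : ℝ) ^ 2 * (a : ℝ) ^ (2 * n) = (((bigM n a b - 1 : ℕ) : ℝ) * (a : ℝ) ^ n) ^ 2 := by ring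
    _ ≤ (2 : ℝ) ^ N * (b : ℝ) ^ (2 * n) := keyR

end Main

/-! ### The output: sign, lengths, and the four clauses of Prop. 1.39 -/

section Final

variable {y : List ℚ} {ε : ℚ}

/-- `sgn · q' = |q'|`. [folklore] -/
theorem sgn_mul_qRaw (y : List ℚ) (ε : ℚ) : sgn y ε * qRaw y ε = |qRaw y ε| := by
  unfold sgn
  split_ifs with h
  · rw [abs_of_neg h]; ring
  · rw [abs_of_nonneg (not_lt.1 h)]; ring

/-- `|sgn| = 1`. [folklore] -/
theorem abs_sgn (y : List ℚ) (ε : ℚ) : |sgn y ε| = 1 := by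
  unfold sgn; split_ifs <;> simp

/-- `p'` has `n` entries. [folklore] -/
theorem length_pRaw (y : List ℚ) (ε : ℚ) : (pRaw y ε).length = y.length := by
  simp [pRaw, List.length_zipWith, scaledNums, length_firstRow]

/-- The entries of `p'`: `p'ᵢ = -zᵢ` when `w = z ᵥ* B`. [cite: LenstraLenstraLovasz1982, proof of Prop. 1.39] -/
theorem pRaw_getElem {z : Fin (y.length + 1) → ℤ}
    (hz : Matrix.vecMul z (inst y ε).basis = (lllOut (inst y ε)).basis ⟨0, Nat.succ_pos _⟩)
    (hq : qRaw y ε = z (Fin.last _)) (i : Fin y.length) (hi : (i : ℕ) < (pRaw y ε).length) :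
    (pRaw y ε)[(i : ℕ)] = - z i.castSucc := by
  have hK0 : (scale y ε : ℤ) ≠ 0 := by exact_mod_cast scale_pos.ne'
  have hks : (i : ℕ) < (scaledNums y ε).length := by simp [scaledNums]
  have hfr : (i : ℕ) < (firstRow y ε).length := by rw [length_firstRow]; omega
  simp only [pRaw, List.getElem_zipWith]
  rw [firstRow_getElem]
  show (qRaw y ε * (scaledNums y ε)[(i : ℕ)]'hks -
      (lllOut (inst y ε)).basis ⟨0, Nat.succ_pos _⟩ i.castSucc) / (scale y ε : ℤ) = _
  rw [hq, ← hz, vecMul_inst_castSucc, ← List.getD_eq_getElem _ (0 : ℤ) hks]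
  rw [show z (Fin.last _) * (scaledNums y ε).getD i 0 -
      (z i.castSucc * (scale y ε : ℤ) + z (Fin.last _) * (scaledNums y ε).getD i 0) = (- z i.castSucc) * (scale y ε : ℤ) by ring,
    Int.mul_ediv_cancel _ hK0]

/-- **LLL82 Prop. 1.39 for the function `approx`**: for `0 < ε < 1`, the output `(p, q)` has `|p| = n`,
`1 ≤ q ≤ 2^{n(n+1)/4} ε^{-n}` and `|q yᵢ - pᵢ| ≤ ε`. [cite: LenstraLenstraLovasz1982, Prop. 1.39] -/
theorem approx_spec (hε : 0 < ε) (hε1 : ε < 1) :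
    (approx (y, ε)).1.length = y.length ∧ 1 ≤ (approx (y, ε)).2 ∧
      ((approx (y, ε)).2 : ℝ) ≤ (2 : ℝ) ^ ((y.length : ℝ) * (y.length + 1) / 4) * ((ε : ℝ)⁻¹) ^ y.length ∧
      ∀ i : Fin y.length, |((approx (y, ε)).2 : ℚ) * y.get i - (((approx (y, ε)).1.getD i 0 : ℤ) : ℚ)| ≤ ε := by
  obtain ⟨z, hz⟩ := exists_coeffs (y := y) hε
  have hK0 : 0 < scale y ε := scale_pos
  have hKR : (0 : ℝ) < scale y ε := by exact_mod_cast hK0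
  have hc0 : 0 < corner y ε := corner_pos hε
  have hcR : (0 : ℝ) < corner y ε := by exact_mod_cast hc0
  have hε1R : (ε : ℝ) < 1 := by exact_mod_cast hε1
  -- the entries of the first reduced row `w = z ᵥ* B`
  have hw_last : (lllOut (inst y ε)).basis ⟨0, Nat.succ_pos _⟩ (Fin.last _) = z (Fin.last _) * corner y ε := by
    rw [← hz, vecMul_inst_last]
  have hw_cs : ∀ j : Fin y.length, (lllOut (inst y ε)).basis ⟨0, Nat.succ_pos _⟩ j.castSucc =
      z j.castSucc * (scale y ε : ℤ) + z (Fin.last _) * (scaledNums y ε).getD j 0 := fun j => by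
    rw [← hz, vecMul_inst_castSucc]
  -- every coordinate is bounded by the norm, which is `< K ε`
  have hnorm := norm_row_lt (y := y) hε
  have hcoord : ∀ j : Fin (y.length + 1),
      |((lllOut (inst y ε)).basis ⟨0, Nat.succ_pos _⟩ j : ℝ)| < (scale y ε : ℝ) * ε := by
    intro j
    have h := abs_apply_le_norm' ((lllOut (inst y ε)).vec ⟨0, Nat.succ_pos _⟩) j
    rw [LatticeInstance.vec_apply] at h
    exact h.trans_lt hnorm
  -- `q' = zₙ`
  have hq : qRaw y ε = z (Fin.last _) := by
    unfold qRaw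
    rw [List.getD_eq_getElem _ _ (by rw [length_firstRow]; omega), firstRow_getElem]
    show (lllOut (inst y ε)).basis ⟨0, Nat.succ_pos _⟩ (Fin.last _) / corner y ε = _
    rw [hw_last, Int.mul_ediv_cancel _ hc0.ne']
  -- `zₙ ≠ 0`: otherwise the first reduced row vanishes
  have hzn : z (Fin.last _) ≠ 0 := by
    intro h0
    apply lllOut_isNonsingular (inst_isNonsingular (y := y) hε)
    refine Matrix.det_eq_zero_of_row_eq_zero ⟨0, Nat.succ_pos _⟩ fun j => ?_
    rcases Fin.eq_castSucc_or_eq_last j with ⟨j, rfl⟩ | rfl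
    · have h1 := hw_cs j
      rw [h0, zero_mul, add_zero] at h1
      have h2 := hcoord j.castSucc
      rw [h1] at h2
      push_cast at h2
      rw [abs_mul, abs_of_pos hKR] at h2
      have h3 : |(z j.castSucc : ℝ)| * (scale y ε : ℝ) < 1 * (scale y ε : ℝ) :=
        h2.trans (by rw [one_mul]; exact mul_lt_of_lt_one_right hKR hε1R)
      have h4 : |z j.castSucc| < 1 := by exact_mod_cast lt_of_mul_lt_mul_right h3 hKR.le
      rw [h1, Int.abs_lt_one_iff.1 h4, zero_mul]
    · rw [hw_last, h0, zero_mul]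
  -- `|zₙ| ≤ M - 1`
  have hzM : |z (Fin.last _)| ≤ (bigM y.length ε.num.natAbs ε.den : ℤ) - 1 := by
    have h2 := hcoord (Fin.last _)
    rw [hw_last, scale_mul_eps y ε hε] at h2
    push_cast at h2
    rw [abs_mul, abs_of_pos hcR] at h2
    have h3 : (|z (Fin.last _)| : ℝ) < bigM y.length ε.num.natAbs ε.den := lt_of_mul_lt_mul_right h2 hcR.le
    have h4 : |z (Fin.last _)| < (bigM y.length ε.num.natAbs ε.den : ℤ) := by exact_mod_cast h3
    exact Int.le_sub_one_iff.2 h4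
  -- the second output
  have hsq : sgn y ε * qRaw y ε = |z (Fin.last _)| := by rw [sgn_mul_qRaw, hq]
  have h2nd : (approx (y, ε)).2 = (|z (Fin.last _)|).toNat := by
    show (sgn y ε * qRaw y ε).toNat = _
    rw [hsq]
  have h2ndZ : ((approx (y, ε)).2 : ℤ) = |z (Fin.last _)| := by
    rw [h2nd, Int.toNat_of_nonneg (abs_nonneg _)]
  refine ⟨?_, ?_, ?_, fun i => ?_⟩
  · -- `|p| = n`
    show ((pRaw y ε).map _).length = _
    rw [List.length_map, length_pRaw]
  · -- `1 ≤ q`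
    rw [h2nd]
    exact Int.lt_toNat.2 (by simpa using abs_pos.2 hzn)
  · -- `q ≤ 2^{n(n+1)/4} ε^{-n}`
    have h1 : ((approx (y, ε)).2 : ℝ) = ((|z (Fin.last _)| : ℤ) : ℝ) := by exact_mod_cast h2ndZ
    have hM1 : 1 ≤ bigM y.length ε.num.natAbs ε.den := bigM_pos _ _ _
    have h2 : ((|z (Fin.last _)| : ℤ) : ℝ) ≤ ((bigM y.length ε.num.natAbs ε.den - 1 : ℕ) : ℝ) := by
      have : ((bigM y.length ε.num.natAbs ε.den - 1 : ℕ) : ℤ) = (bigM y.length ε.num.natAbs ε.den : ℤ) - 1 := by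
        push_cast [Nat.cast_sub hM1]; ring
      exact_mod_cast (hzM.trans_eq this.symm)
    rw [h1]
    exact h2.trans (bigM_pred_le y hε)
  · -- `|q yᵢ - pᵢ| ≤ ε`
    have hi : (i : ℕ) < (pRaw y ε).length := by rw [length_pRaw]; exact i.is_lt
    have hp : (approx (y, ε)).1.getD i 0 = sgn y ε * (- z i.castSucc) := by
      show ((pRaw y ε).map _).getD i 0 = _
      rw [List.getD_eq_getElem _ _ (by simpa using hi), List.getElem_map, pRaw_getElem hz hq i hi]
    have hqQ : ((approx (y, ε)).2 : ℚ) = sgn y ε * z (Fin.last _) := by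
      rw [← Int.cast_natCast, h2ndZ, ← hq, ← sgn_mul_qRaw]
      push_cast
      ring
    have hcomb : ((scale y ε : ℤ) : ℚ) * (z (Fin.last _) * y.get i + z i.castSucc) =
        (((lllOut (inst y ε)).basis ⟨0, Nat.succ_pos _⟩ i.castSucc : ℤ) : ℚ) := by
      rw [hw_cs i]
      push_cast
      rw [scaledNums_getD i]
      ring
    have hlt : |(((lllOut (inst y ε)).basis ⟨0, Nat.succ_pos _⟩ i.castSucc : ℤ) : ℚ)| < (scale y ε : ℚ) * ε := by
      exact_mod_cast hcoord i.castSucc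
    have hKQ : (0 : ℚ) < (scale y ε : ℚ) := by exact_mod_cast hK0
    rw [← hcomb] at hlt
    push_cast at hlt
    rw [abs_mul, abs_of_pos hKQ] at hlt
    have key : |(z (Fin.last _) : ℚ) * y.get i + z i.castSucc| < ε := lt_of_mul_lt_mul_left hlt hKQ.le
    have hs : |(sgn y ε : ℚ)| = 1 := by exact_mod_cast abs_sgn y ε
    rw [hp, hqQ]
    have e : (sgn y ε : ℚ) * (z (Fin.last _) : ℚ) * y.get i - ((sgn y ε * -z i.castSucc : ℤ) : ℚ) =
        (sgn y ε : ℚ) * ((z (Fin.last _) : ℚ) * y.get i + z i.castSucc) := by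
      push_cast
      ring
    rw [e, abs_mul, hs, one_mul]
    exact key.le

end Final

end SimApproxLLL

/-- **Discharge of `LLL1982_prop_1_39` (LLL82, Proposition 1.39; Bremner 2011, Prop. 9.4; Schrijver,
Cor. 6.4c): simultaneous Diophantine approximation in polynomial time.** The witness is
`SimApproxLLL.approx`: on `(y, ε)` with `n = |y|`, `ε = a/b`, it forms `V = ∏ den(yᵢ)`,
`M = ⌊2^{n(n+1)/4} ε⁻ⁿ⌋ + 1` (by integer square roots), `K = bMV`, LLL-reduces (by the tree's
polynomial-time machine `lllMachineF`, LLL82 Prop. 1.26) the integer basis `K e₁, …, K eₙ,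
(K y₁, …, K yₙ, aV)` of `K · L`, `L` the lattice of the printed proof with the corner entry
`2^{-n(n+1)/4} ε^{n+1}` replaced by the rational `ε/M`, reads `q, p₁, …, pₙ` off the first reduced
vector and normalises the sign of `q`. Polynomial time: `SimApproxLLL.approx_polyTime` (typed
`CodeFP` algebra). Correctness: `SimApproxLLL.approx_spec` — LLL82 (1.9) gives `‖b₁‖ < Kε`
(`SimApproxLLL.norm_row_lt`, using `Q₀ < M`), whence `|q yᵢ - pᵢ| < ε`, `q ≠ 0` (as `ε < 1`) and
`|q| < M`, i.e. `|q| ≤ M - 1 ≤ Q₀ = 2^{n(n+1)/4} ε⁻ⁿ` (`SimApproxLLL.bigM_pred_le`).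

Deviation from the printed proof (documented): LLL82 (Remark 1.37) and Schrijver (Thm. 6.4) run the
reduction on the rational GRAM matrix, the corner entry `2^{-n(n+1)/4} ε^{n+1}` being irrational for
`n ≡ 1, 2 (mod 4)` (Bremner: "the entry in the upper left corner may not be rational"); the tree's
LLL machine takes integer bases, so the corner is replaced by `ε/M` with the INTEGER
`M = ⌊Q₀⌋ + 1 ∈ (Q₀, Q₀ + 1]`, which yields exactly the printed bounds (strictly: `|q yᵢ - pᵢ| < ε`,
`1 ≤ q ≤ ⌊Q₀⌋`). [cite: LenstraLenstraLovasz1982, Prop. 1.39] [cite: Bremner2011, §9.2 Prop. 9.4] -/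
theorem LLL1982_prop_1_39_holds : LLL1982_prop_1_39 :=
  ⟨SimApproxLLL.approx, SimApproxLLL.approx_polyTime, fun _ _ hε hε1 => SimApproxLLL.approx_spec hε hε1⟩

end Literature.Algebra.EuclideanLattices

end
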